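import Summits.Ventures.PercRepro0.Defs

/-!
# L2 · RIGHT-CONT, part 1 (G1): the finite-box structure of `{0 ↔ ∞}`, against `Defs.lean` (seat p5)

Cell pub-perc-repro0, seat p2.  Against `Summit.Ventures.PercRepro0.Defs` this file proves

* `conn_iff_reflTransGen` : the graph-theoretic `Conn` of `Defs` is the reflexive–transitive closure of
  "joined by an open bond";
* G1 : the first-exit lemma `reach_of_conn`; `percolates d = ⋂ₙ toBoundary d (n+1)`
  (`percolates_eq_iInter_toBoundary`); the events `{x ↔ y}`, `{0 ↔ ∂Λ_n}`, `{0 ↔ ∞}` are measurable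
  (F1-type facts `measurableSet_conn`, `measurableSet_toBoundary`, `measurableSet_percolates`);
  `P_p(0 ↔ ∂Λ_n) → θ_d(p)` (`tendsto_toBoundary`, the first half of `L2_RightCont`).

Part 2 (`RightCont.lean`): continuity of `p ↦ P_p(0 ↔ ∂Λ_n)` and right-continuity of `θ_d`.
The arguments are those of proofs/GLUE-p2-v2.md (G1).
-/

open MeasureTheory ProbabilityTheory unitInterval
open scoped ENNReal Topology

namespace Summit.Ventures.PercRepro0.L2

open Summit.Ventures.PercRepro0.Defs

variable {d : ℕ}

-- BEGIN BODY

/-! ### The sup-norm -/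

/-- The sup-norm `‖x‖_∞ = max_i |x_i|` of a vertex, as a natural number. -/
def nrm (x : Vertex d) : ℕ := Finset.univ.sup fun i => (x i).natAbs

/-- Each coordinate is bounded by the sup-norm. -/
lemma natAbs_le_nrm (x : Vertex d) (i : Fin d) : (x i).natAbs ≤ nrm x :=
  Finset.le_sup (f := fun i => (x i).natAbs) (Finset.mem_univ i)

/-- `‖x‖_∞ ≤ n` iff every coordinate is bounded by `n`. -/
lemma nrm_le_iff {x : Vertex d} {n : ℕ} : nrm x ≤ n ↔ ∀ i, (x i).natAbs ≤ n := by
  simp [nrm, Finset.sup_le_iff]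

/-- The origin has sup-norm `0`. -/
@[simp] lemma nrm_zero : nrm (0 : Vertex d) = 0 := by simp [nrm]

/-- `x ∈ Λ_n` iff `‖x‖_∞ ≤ n`. -/
lemma mem_box_iff {x : Vertex d} {n : ℕ} : x ∈ box d n ↔ nrm x ≤ n := by
  simp only [box, Set.mem_setOf_eq, nrm_le_iff, Int.abs_eq_natAbs]
  constructor
  · intro h i; have := h i; omega
  · intro h i; have := h i; omega

/-- For `n ≥ 1`, `x ∈ ∂Λ_n` iff `‖x‖_∞ = n`. -/
lemma mem_boundary_iff {x : Vertex d} {n : ℕ} (hn : 1 ≤ n) : x ∈ boundary d n ↔ nrm x = n := by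
  simp only [boundary, Set.mem_setOf_eq, Int.abs_eq_natAbs]
  constructor
  · rintro ⟨h1, i, hi⟩
    refine le_antisymm (nrm_le_iff.2 fun j => by have := h1 j; omega) ?_
    have := natAbs_le_nrm x i
    omega
  · intro h
    refine ⟨fun j => by have := natAbs_le_nrm x j; omega, ?_⟩
    have hd : (Finset.univ : Finset (Fin d)).Nonempty := by
      rcases Nat.eq_zero_or_pos d with h0 | h0
      · subst h0
        simp [nrm] at h
        omega
      · exact ⟨⟨0, h0⟩, Finset.mem_univ _⟩
    obtain ⟨i, -, hi⟩ := Finset.exists_mem_eq_sup (Finset.univ : Finset (Fin d)) hd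
      fun i => (x i).natAbs
    refine ⟨i, ?_⟩
    have : nrm x = (x i).natAbs := hi
    omega

/-- The box `Λ_m` is finite. -/
lemma finite_box (m : ℕ) : {x : Vertex d | nrm x ≤ m}.Finite := by
  refine (Set.Finite.pi (t := fun _ : Fin d => Set.Icc (-(m : ℤ)) m)
    fun _ => Set.finite_Icc _ _).subset ?_
  intro x hx
  simp only [Set.mem_setOf_eq, nrm_le_iff] at hx
  simp only [Set.mem_pi, Set.mem_univ, Set.mem_Icc, true_implies]
  intro i
  have := hx i
  omega

/-- Along a lattice bond the sup-norm changes by at most one. -/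
lemma nrm_le_of_adj {x y : Vertex d} (h : (lattice d).Adj x y) : nrm y ≤ nrm x + 1 := by
  have hsum : (∑ i, |x i - y i|) = 1 := h
  rw [nrm_le_iff]
  intro i
  have hi : |x i - y i| ≤ 1 := by
    rw [← hsum]
    exact Finset.single_le_sum (fun j _ => abs_nonneg (x j - y j)) (Finset.mem_univ i)
  have h2 := natAbs_le_nrm x i
  rw [Int.abs_eq_natAbs] at hi
  omega

/-! ### Connectivity as a reflexive–transitive closure -/

/-- `x` and `y` are joined by an open bond. -/
def OAdj (ω : Config d) (x y : Vertex d) : Prop := (lattice d).Adj x y ∧ s(x, y) ∈ ω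

/-- Adjacency in the open graph is exactly "joined by an open bond". -/
lemma openGraph_adj_iff (ω : Config d) (x y : Vertex d) :
    (openGraph d ω).Adj x y ↔ OAdj ω x y := by
  simp only [openGraph, SimpleGraph.fromEdgeSet_adj, Set.mem_inter_iff, bonds,
    SimpleGraph.mem_edgeSet, OAdj]
  constructor
  · rintro ⟨⟨h1, h2⟩, -⟩; exact ⟨h2, h1⟩
  · rintro ⟨h1, h2⟩; exact ⟨⟨h2, h1⟩, (lattice d).ne_of_adj h1⟩

/-- `Conn` is the reflexive–transitive closure of `OAdj`. -/
lemma conn_iff_reflTransGen (ω : Config d) (x y : Vertex d) :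
    Conn d ω x y ↔ Relation.ReflTransGen (OAdj ω) x y := by
  unfold Conn
  rw [SimpleGraph.reachable_iff_reflTransGen]
  constructor
  · intro h
    induction h with
    | refl => exact Relation.ReflTransGen.refl
    | tail _ hadj ih => exact ih.tail ((openGraph_adj_iff ω _ _).1 hadj)
  · intro h
    induction h with
    | refl => exact Relation.ReflTransGen.refl
    | tail _ hadj ih => exact ih.tail ((openGraph_adj_iff ω _ _).2 hadj)

/-- Adjacency by an open bond with both endpoints in `Λ_n`. -/
def OAdjIn (n : ℕ) (ω : Config d) (x y : Vertex d) : Prop :=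
  OAdj ω x y ∧ nrm x ≤ n ∧ nrm y ≤ n

/-- Connection by an open path inside `Λ_n`. -/
def ConnIn (n : ℕ) (ω : Config d) : Vertex d → Vertex d → Prop :=
  Relation.ReflTransGen (OAdjIn n ω)

/-- A connection inside a box is a connection. -/
lemma conn_of_connIn {n : ℕ} {ω : Config d} {x y : Vertex d} (h : ConnIn n ω x y) :
    Conn d ω x y := by
  rw [conn_iff_reflTransGen]
  induction h with
  | refl => exact Relation.ReflTransGen.refl
  | tail _ hadj ih => exact ih.tail hadj.1

/-- First-exit lemma (G1(a)): an open path from the origin to a vertex of sup-norm `≥ n` contains a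
vertex of sup-norm exactly `n` reached by an open path inside `Λ_n`. -/
lemma reach_of_conn {n : ℕ} {ω : Config d} {x : Vertex d} (h : Conn d ω 0 x) (hx : n ≤ nrm x) :
    ∃ y, nrm y = n ∧ ConnIn n ω 0 y := by
  rw [conn_iff_reflTransGen] at h
  have key : ∀ z, Relation.ReflTransGen (OAdj ω) 0 z →
      (nrm z ≤ n ∧ ConnIn n ω 0 z) ∨ ∃ y, nrm y = n ∧ ConnIn n ω 0 y := by
    intro z hz
    induction hz with
    | refl => exact Or.inl ⟨by simp, Relation.ReflTransGen.refl⟩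
    | @tail z' z _ hadj ih =>
      rcases ih with ⟨hz', hc⟩ | hy
      · by_cases hzn : nrm z ≤ n
        · exact Or.inl ⟨hzn, hc.tail ⟨hadj, hz', hzn⟩⟩
        · have := nrm_le_of_adj hadj.1
          exact Or.inr ⟨z', by omega, hc⟩
      · exact Or.inr hy
  rcases key x h with ⟨hxn, hc⟩ | hy
  · exact ⟨x, le_antisymm hxn hx, hc⟩
  · exact hy

/-- The event `A_n` in the form "a vertex of norm `n` is reached inside `Λ_n`". -/
def reach (d n : ℕ) : Set (Config d) := {ω | ∃ y, nrm y = n ∧ ConnIn n ω 0 y}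

/-- For `n ≥ 1`, `toBoundary d n = reach d n`. -/
lemma toBoundary_eq_reach {n : ℕ} (hn : 1 ≤ n) : toBoundary d n = reach d n := by
  ext ω
  simp only [toBoundary, reach, Set.mem_setOf_eq]
  constructor
  · rintro ⟨y, hy, hc⟩
    exact reach_of_conn hc ((mem_boundary_iff hn).1 hy).ge
  · rintro ⟨y, hy, hc⟩
    exact ⟨y, (mem_boundary_iff hn).2 hy, conn_of_connIn hc⟩

/-- The events `reach d n` decrease in `n` (G1(b)). -/
lemma reach_antitone : Antitone (reach d) := by
  refine antitone_nat_of_succ_le fun n ω hω => ?_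
  obtain ⟨y, hy, hc⟩ := hω
  exact reach_of_conn (conn_of_connIn hc) (by omega)

/-- G1(c): `{0 ↔ ∞} = ⋂ₙ reach d n`. -/
lemma percolates_eq_iInter : percolates d = ⋂ n, reach d n := by
  ext ω
  simp only [percolates, ConnInf, Set.mem_setOf_eq, Set.mem_iInter]
  constructor
  · intro hinf n
    obtain ⟨x, hx, hxn⟩ : ∃ x ∈ cluster d ω 0, n ≤ nrm x := by
      by_contra hcon
      push Not at hcon
      exact hinf ((finite_box n).subset fun x hx => (hcon x hx).le)
    exact reach_of_conn hx hxn
  · intro h hfin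
    obtain ⟨m, hm⟩ := (hfin.image nrm).bddAbove
    obtain ⟨y, hy, hc⟩ := h (m + 1)
    have hmem : y ∈ cluster d ω 0 := conn_of_connIn hc
    have := hm (Set.mem_image_of_mem nrm hmem)
    omega

/-- G1(c) in the form of `Defs.toBoundary`: `{0 ↔ ∞} = ⋂ₙ {0 ↔ ∂Λ_{n+1}}`. -/
lemma percolates_eq_iInter_toBoundary : percolates d = ⋂ n, toBoundary d (n + 1) := by
  rw [percolates_eq_iInter]
  apply le_antisymm
  · exact Set.iInter_mono' fun n => ⟨n + 1, by rw [toBoundary_eq_reach (by omega)]⟩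
  · refine Set.iInter_mono' fun n => ⟨n, ?_⟩
    rw [toBoundary_eq_reach (by omega)]
    exact reach_antitone (Nat.le_succ n)

/-! ### Measurability -/

/-- Reachability events are measurable: if every one-step event `{ω | R ω a b}` is measurable and
the vertex type is countable, so is `{ω | ReflTransGen (R ω) a b}` (a countable union over chains). -/
lemma measurableSet_reflTransGen {α : Type*} [Countable α] {Ω : Type*} [MeasurableSpace Ω]
    (R : Ω → α → α → Prop) (hR : ∀ a b, MeasurableSet {ω | R ω a b}) (a b : α) :
    MeasurableSet {ω | Relation.ReflTransGen (R ω) a b} := by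
  have hchain : ∀ (l : List α) (a : α), MeasurableSet {ω | List.IsChain (R ω) (a :: l)} := by
    intro l
    induction l with
    | nil => intro a; simp
    | cons c l ih =>
      intro a
      simp only [List.isChain_cons_cons]
      exact (hR a c).inter (ih c)
  have : {ω | Relation.ReflTransGen (R ω) a b} =
      ⋃ l : List α, {ω | List.IsChain (R ω) (a :: l) ∧
        (a :: l).getLast (List.cons_ne_nil a l) = b} := by
    ext ω
    simp only [Set.mem_setOf_eq, Set.mem_iUnion]
    constructor
    · intro h
      exact List.exists_isChain_cons_of_relationReflTransGen h
    · rintro ⟨l, hl, hlast⟩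
      exact List.relationReflTransGen_of_exists_isChain_cons l hl hlast
  rw [this]
  refine MeasurableSet.iUnion fun l => ?_
  by_cases hb : (a :: l).getLast (List.cons_ne_nil a l) = b
  · simp only [hb, and_true]
    exact hchain l a
  · simp [hb]

/-- The one-bond events `{ω | OAdj ω x y}` are measurable. -/
lemma measurableSet_oAdj (x y : Vertex d) : MeasurableSet {ω : Config d | OAdj ω x y} := by
  have : {ω : Config d | OAdj ω x y} = {_ω | (lattice d).Adj x y} ∩ {ω | s(x, y) ∈ ω} := by
    ext ω; simp [OAdj]
  rw [this]
  exact (MeasurableSet.const _).inter (measurableSet_mem _)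

/-- The events `{ω | OAdjIn n ω x y}` are measurable. -/
lemma measurableSet_oAdjIn (n : ℕ) (x y : Vertex d) :
    MeasurableSet {ω : Config d | OAdjIn n ω x y} := by
  have : {ω : Config d | OAdjIn n ω x y} =
      {ω | OAdj ω x y} ∩ {_ω | nrm x ≤ n ∧ nrm y ≤ n} := by
    ext ω; simp [OAdjIn]
  rw [this]
  exact (measurableSet_oAdj x y).inter (MeasurableSet.const _)

/-- The events `{x ↔ y}` are measurable (F1). -/
lemma measurableSet_conn (x y : Vertex d) : MeasurableSet {ω : Config d | Conn d ω x y} := by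
  have : {ω : Config d | Conn d ω x y} = {ω | Relation.ReflTransGen (OAdj ω) x y} := by
    ext ω; exact conn_iff_reflTransGen ω x y
  rw [this]
  exact measurableSet_reflTransGen (fun ω => OAdj ω) measurableSet_oAdj x y

/-- The events `{x ↔ y inside Λ_n}` are measurable. -/
lemma measurableSet_connIn (n : ℕ) (x y : Vertex d) :
    MeasurableSet {ω : Config d | ConnIn n ω x y} :=
  measurableSet_reflTransGen (fun ω => OAdjIn n ω) (measurableSet_oAdjIn n) x y

/-- The events `reach d n` are measurable. -/
lemma measurableSet_reach (n : ℕ) : MeasurableSet (reach d n) := by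
  have : reach d n = ⋃ y : Vertex d, ⋃ (_ : nrm y = n), {ω | ConnIn n ω 0 y} := by
    ext ω; simp [reach]
  rw [this]
  exact MeasurableSet.iUnion fun y => MeasurableSet.iUnion fun _ => measurableSet_connIn n 0 y

/-- The events `{0 ↔ ∂Λ_n}` are measurable (F1). -/
lemma measurableSet_toBoundary (n : ℕ) : MeasurableSet (toBoundary d n) := by
  have : toBoundary d n = ⋃ y : Vertex d, ⋃ (_ : y ∈ boundary d n), {ω | Conn d ω 0 y} := by
    ext ω; simp [toBoundary]
  rw [this]
  exact MeasurableSet.iUnion fun y => MeasurableSet.iUnion fun _ => measurableSet_conn 0 y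

/-- The event `{0 ↔ ∞}` is measurable (F1). -/
lemma measurableSet_percolates : MeasurableSet (percolates d) := by
  rw [percolates_eq_iInter]
  exact MeasurableSet.iInter fun n => measurableSet_reach n

/-- G1(c): `P_p(0 ↔ ∂Λ_n) → θ_d(p)` as `n → ∞` (first half of `L2_RightCont`). -/
lemma tendsto_toBoundary (p : I) :
    Filter.Tendsto (fun n : ℕ => (P d p (toBoundary d n)).toReal) Filter.atTop
      (𝓝 (thetaI d p)) := by
  unfold thetaI
  rw [percolates_eq_iInter_toBoundary]
  have h := tendsto_measure_iInter_atTop (μ := P d p)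
    (fun n => (measurableSet_toBoundary (d := d) (n + 1)).nullMeasurableSet)
    (fun m n hmn => by
      rw [toBoundary_eq_reach (by omega), toBoundary_eq_reach (by omega)]
      exact reach_antitone (Nat.succ_le_succ hmn))
    ⟨0, measure_ne_top _ _⟩
  have h' := (ENNReal.tendsto_toReal (measure_ne_top _ _)).comp h
  exact (Filter.tendsto_add_atTop_iff_nat 1).1 h'

/-- `θ_d(p) ≤ P_p(0 ↔ ∂Λ_n)` for every `n ≥ 1`. -/
lemma thetaI_le_toBoundary (p : I) {n : ℕ} (hn : 1 ≤ n) :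
    thetaI d p ≤ (P d p (toBoundary d n)).toReal := by
  unfold thetaI
  rw [percolates_eq_iInter, toBoundary_eq_reach hn]
  exact ENNReal.toReal_mono (measure_ne_top _ _) (measure_mono (Set.iInter_subset _ n))

-- END BODY

end Summit.Ventures.PercRepro0.L2
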